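import Mathlib
import Summits.Ventures.PercRepro2.Defs
import Summits.Ventures.PercRepro2.Independence
import Summits.Ventures.PercRepro2.Harris
import Summits.Ventures.PercRepro2.Graph
import Summits.Ventures.PercRepro2.Exploration
import Summits.Ventures.PercRepro2.Events
import Summits.Ventures.PercRepro2.RBDefs
import Summits.Ventures.PercRepro2.RBClubDefs

/-!
# The «w ∈ C_s» split of row 2′RB and candidate row 2′RB-CLUB (blind cell PercRepro2, mine-a g7;
MINE-A.md §43–§45, proofs/MINEA-CLUB.md)

Setting as in `RBDefs`: roots `s, t`, `Q = {s ↮ t}` (`Qst`), third vertex `w`, markers `b, o`,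
`bL = {b ↔ s}`, `oL = {o ↔ s}`. Let `M = {s ↔ w} = {w ∈ C_s}` (`connEvent ends s w`).

* **The split** (`rbSum_eq_split`): on an atom `{C(w) = A}` with `s ∈ A` the events `bL`, `oL` are
  determined by `A` (`C(w) = C(s)` there), so its Rao–Blackwell term is `P(Q ∩ {C(w) = A} ∩ bL ∩ oL)`;
  summing, `rbSum bL oL = P(Q ∩ M ∩ bL ∩ oL) + rbSumFree bL oL`, where `rbSumFree` is the sum over
  the atoms `A ∌ s` (the (T+N)-part of MINE-A.md §40).
* `Club` (candidate row 2′RB-CLUB) and `TNsame` (the TN theorem's statement) are defined in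
  `RBClubDefs.lean`.
* **`RBsame_of_club_of_TNsame`**: `Club → TNsame → RBsame` — row 2′RB (same form) reduces to
  the Rao–Blackwell-free inequality `Club` once the TN theorem is in the kernel.
-/

namespace Summit.Ventures.PercRepro2

namespace RB

open scoped Classical

variable {V : Type*} {E : Type*} [Fintype E] [DecidableEq E] [Fintype V] [DecidableEq V]
  {R : Type*} [Field R] [LinearOrder R] [IsStrictOrderedRing R]

/-! ## Clusters of connected vertices coincide -/

section Clusters

variable {ends : E → Sym2 V} {ω : Config E}

omit [Fintype E] [DecidableEq E] [Fintype V] [DecidableEq V] in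
/-- Connected vertices have the same cluster. -/
lemma cluster_eq_of_conn {s w : V} (h : Conn ends ω s w) :
    cluster ends ω s = cluster ends ω w := by
  ext u
  simp only [mem_cluster]
  exact ⟨fun hu => conn_trans (conn_symm h) hu, fun hu => conn_trans h hu⟩

omit [Fintype E] [DecidableEq E] [Fintype V] [DecidableEq V] in
/-- On `{C(w) = A}` with `s ∈ A`, `{b ↔ s}` is the constant `[b ∈ A]`. -/
lemma conn_iff_mem_of_clusterEvent {s w b : V} {A : Set V} (hA : ω ∈ clusterEvent ends w A)
    (hs : s ∈ A) : Conn ends ω b s ↔ b ∈ A := by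
  rw [mem_clusterEvent] at hA
  have hsw : Conn ends ω w s := by
    rw [← mem_cluster, hA]; exact hs
  have hcl : cluster ends ω s = cluster ends ω w := cluster_eq_of_conn (conn_symm hsw)
  rw [← hA, ← hcl, mem_cluster]
  exact ⟨conn_symm, conn_symm⟩

omit [Fintype E] [DecidableEq E] [Fintype V] [DecidableEq V] in
/-- On `{C(w) = A}`, `{s ↔ w}` is the constant `[s ∈ A]`. -/
lemma conn_sw_iff_mem_of_clusterEvent {s w : V} {A : Set V} (hA : ω ∈ clusterEvent ends w A) :
    Conn ends ω s w ↔ s ∈ A := by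
  rw [mem_clusterEvent] at hA
  rw [← hA, mem_cluster]
  exact ⟨conn_symm, conn_symm⟩

end Clusters

/-! ## The free part of the Rao–Blackwell sum and the split -/

section Split

variable (p : E → R) (ends : E → Sym2 V) (s t w : V)

variable {p}

omit [Fintype E] [DecidableEq E] [Fintype V] [DecidableEq V] in
/-- If `b ∈ A` then `Q ∩ {C(w) = A} ∩ {b ↔ s} = Q ∩ {C(w) = A}` (for `s ∈ A`). -/
lemma Qst_inter_clusterEvent_inter_connEvent_of_mem {A : Set V} (hs : s ∈ A) {b : V}
    (hb : b ∈ A) :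
    Qst ends s t ∩ clusterEvent ends w A ∩ connEvent ends b s =
      Qst ends s t ∩ clusterEvent ends w A := by
  ext ω
  constructor
  · exact fun h => h.1
  · intro h
    exact ⟨h, (conn_iff_mem_of_clusterEvent h.2 hs).mpr hb⟩

omit [Fintype E] [DecidableEq E] [Fintype V] [DecidableEq V] in
/-- If `b ∉ A` then `Q ∩ {C(w) = A} ∩ {b ↔ s} = ∅` (for `s ∈ A`). -/
lemma Qst_inter_clusterEvent_inter_connEvent_of_notMem {A : Set V} (hs : s ∈ A) {b : V}
    (hb : b ∉ A) :
    Qst ends s t ∩ clusterEvent ends w A ∩ connEvent ends b s = ∅ := by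
  refine Set.eq_empty_iff_forall_notMem.mpr fun ω h => ?_
  obtain ⟨⟨_, hA⟩, hb'⟩ := h
  exact hb ((conn_iff_mem_of_clusterEvent hA hs).mp hb')

omit [Fintype V] [DecidableEq V] [IsStrictOrderedRing R] in
/-- On an atom `A ∋ s` the Rao–Blackwell term is the probability of the intersection. -/
lemma rbTerm_of_mem (p : E → R) (b o : V) {A : Set V} (hs : s ∈ A) :
    prob p (Qst ends s t ∩ clusterEvent ends w A ∩ connEvent ends b s) *
        prob p (Qst ends s t ∩ clusterEvent ends w A ∩ connEvent ends o s) /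
      prob p (Qst ends s t ∩ clusterEvent ends w A) =
    prob p (Qst ends s t ∩ clusterEvent ends w A ∩ connEvent ends b s ∩ connEvent ends o s) := by
  by_cases hb : b ∈ A
  · by_cases ho : o ∈ A
    · rw [Qst_inter_clusterEvent_inter_connEvent_of_mem ends s t w hs hb,
        Qst_inter_clusterEvent_inter_connEvent_of_mem ends s t w hs ho]
      by_cases h0 : prob p (Qst ends s t ∩ clusterEvent ends w A) = 0
      · rw [h0]; simp
      · field_simp
    · rw [Qst_inter_clusterEvent_inter_connEvent_of_mem ends s t w hs hb,
        Qst_inter_clusterEvent_inter_connEvent_of_notMem ends s t w hs ho]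
      simp
  · rw [Qst_inter_clusterEvent_inter_connEvent_of_notMem ends s t w hs hb]
    simp

omit [Fintype E] [DecidableEq E] [Fintype V] [DecidableEq V] in
/-- `Q ∩ {s ↔ w} ∩ bL ∩ oL ∩ {C(w) = A}` is `Q ∩ {C(w) = A} ∩ bL ∩ oL` if `s ∈ A`, empty otherwise. -/
lemma Qst_inter_conn_inter_clusterEvent (b o : V) (A : Set V) :
    Qst ends s t ∩ connEvent ends s w ∩ connEvent ends b s ∩ connEvent ends o s ∩
        clusterEvent ends w A =
      if s ∈ A then Qst ends s t ∩ clusterEvent ends w A ∩ connEvent ends b s ∩ connEvent ends o s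
      else ∅ := by
  split_ifs with hs
  · ext ω
    simp only [Set.mem_inter_iff]
    constructor
    · rintro ⟨⟨⟨⟨hQ, _⟩, hb⟩, ho⟩, hA⟩
      exact ⟨⟨⟨hQ, hA⟩, hb⟩, ho⟩
    · rintro ⟨⟨⟨hQ, hA⟩, hb⟩, ho⟩
      exact ⟨⟨⟨⟨hQ, (conn_sw_iff_mem_of_clusterEvent hA).mpr hs⟩, hb⟩, ho⟩, hA⟩
  · refine Set.eq_empty_iff_forall_notMem.mpr fun ω h => ?_
    obtain ⟨⟨⟨⟨_, hsw⟩, _⟩, _⟩, hA⟩ := h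
    exact hs ((conn_sw_iff_mem_of_clusterEvent hA).mp hsw)

omit [DecidableEq V] [IsStrictOrderedRing R] in
/-- **The split**: `rbSum bL oL = P(Q ∩ {s ↔ w} ∩ bL ∩ oL) + rbSumFree bL oL`. -/
theorem rbSum_eq_split (p : E → R) (b o : V) :
    rbSum p ends s t w (connEvent ends b s) (connEvent ends o s) =
      prob p (Qst ends s t ∩ connEvent ends s w ∩ connEvent ends b s ∩ connEvent ends o s) +
        rbSumFree p ends s t w (connEvent ends b s) (connEvent ends o s) := by
  unfold rbSum rbSumFree
  rw [← sum_prob_inter_clusterEvent p ends w, ← Finset.sum_add_distrib]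
  refine Finset.sum_congr rfl fun A _ => ?_
  rw [Qst_inter_conn_inter_clusterEvent ends s t w b o A]
  split_ifs with hs
  · rw [rbTerm_of_mem ends s t w p b o hs, add_zero]
  · simp

end Split

/-! ## The rows -/

section Rows

variable (p : E → R) (ends : E → Sym2 V) (o b s t w : V)

variable {p}

omit [DecidableEq V] in
/-- **`Club` and the TN theorem give row 2′RB (same form)**. -/
theorem RBsame_of_club_of_TNsame (hc : Club p ends o b s t w)
    (ht : TNsame p ends o b s t w) : RBsame p ends o b s t w := by
  unfold RBsame
  rw [rbSum_eq_split ends s t w p b o]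
  unfold Club at hc
  unfold TNsame at ht
  linarith

end Rows

end RB

end Summit.Ventures.PercRepro2
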